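import Literature.Probability.RandomPlanarGeometry.HexSAWBrickWallStripFugacityTwoSided
import Literature.Probability.RandomPlanarGeometry.HexSAWBrickWallStripFugacityLevel0SqrtMonotone
import Mathlib.Analysis.SpecialFunctions.Pow.Continuity
import Mathlib.Analysis.MeanInequalities
import Mathlib.Analysis.Convex.Continuous
import HarnessLib

/-!
# BBdGDCG 2014 Proposition 6, two-fugacity riders: `μ_T(y,z)` is non-decreasing in `y` and in `z`, JOINTLY log-convex in `(log y, log z)`, and obeys the two-sided `√`-law `μ_T(y',z') ≤ √(y'z'/(yz)) · μ_T(y,z)`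

Topic `Literature/Probability/RandomPlanarGeometry` (continues `HexSAWBrickWallStripFugacityTwoSided.lean` — the
two-fugacity growth rate `HexBW.stripMuY₂ T y z = μ_T(y,z)` of the brick-wall strip `S_T`, `tendsto_stripZ₂_rpow`,
`stripMuY₂_symm` — and `HexSAWBrickWallStripFugacityLevel0SqrtMonotone.lean`: the parity bound
`bottomVisits₀_le_div_two_succ : bc(ω) ≤ n/2 + 1` and the one-variable `√`-law `stripMuY₀_le_sqrt_mul`).
Source: N. R. Beaton, M. Bousquet-Mélou, J. de Gier, H. Duminil-Copin, A. J. Guttmann, Comm. Math. Phys. 326 (2014),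
arXiv:1109.0358v5, Proposition 6 (p. 10): "`μ_T(y,z)` is finite, and non-decreasing in `y` and `z`. … Finally,
`μ_T(1,y)` is a log-convex and thus continuous function of `log y`."  The header of `…TwoSided.lean` records that the
monotonicity in `(y,z)` was NOT treated there; it is supplied here (termwise, then Fekete limits), together with two
statements the source does not print but which follow from the same one-line arguments: JOINT log-convexity of
`(u,v) ↦ log μ_T(eᵘ,eᵛ)` on `ℝ²` (Hölder on the finite sums `C_{T,n}`, as in Hammersley–Torrie–Whittington 1982 (2.12)
for the one-variable case), and the two-sided half-power law (parity of the bottom row: two consecutive vertices of a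
walk are never both weighted, so `bc(ω) ≤ n/2 + 1`; the top row by the symmetry `μ_T(y,z) = μ_T(z,y)`).
The printed clause for `μ_T(1,y)` itself is `convexOn_log_stripMuY₀_exp` of `HexSAWBrickWallStripFugacityLevel0Prop6.lean`
read through `stripMuY₂_one_left`; the joint continuity of `μ_T(y,z)` on `(0,∞)²` ("and thus continuous") is derived
here from the joint log-convexity (Mathlib's `ConvexOn.continuousOn` in finite dimension).

## Statements (namespace `Literature.Probability.RandomPlanarGeometry.SAW.HexBW`, all PROVED, standard axioms)

* `stripZ₂_nonneg`, `stripZ₂_mono_left`, `stripZ₂_mono_right`; **`stripMuY₂_mono_left`, `stripMuY₂_mono_right`**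
  (Proposition 6: "non-decreasing in `y` and `z`");
* `stripZ₂_rpow_mul_rpow_le` (joint Hölder), **`stripMuY₂_rpow_mul_rpow_le`**:
  `μ_T(y₁^θ y₂^{1-θ}, z₁^θ z₂^{1-θ}) ≤ μ_T(y₁,z₁)^θ μ_T(y₂,z₂)^{1-θ}`, `log_stripMuY₂_rpow_mul_rpow_le`,
  **`convexOn_log_stripMuY₂_exp`** (joint convexity on `ℝ × ℝ`), `continuous_log_stripMuY₂_exp`,
  **`continuousOn_stripMuY₂`** (joint continuity on `(0,∞)²`);
* `stripZ₂_le_pow_half_mul_left`, **`stripMuY₂_le_sqrt_mul_left`** (`μ_T(y',z) ≤ √(y'/y) μ_T(y,z)` for `y ≤ y'`),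
  `stripMuY₂_le_sqrt_mul_right`, **`stripMuY₂_le_sqrt_mul_sqrt_mul`**, `antitoneOn_stripMuY₂_div_sqrt_left`,
  `antitoneOn_stripMuY₂_div_sqrt_right`.
-/

noncomputable section

open Filter Topology Finset Literature.Probability.LatticeModels Literature.Probability.Percolation SimpleGraph

namespace Literature.Probability.RandomPlanarGeometry.SAW.HexBW

variable {y y' y₁ y₂ z z' z₁ z₂ θ : ℝ}

/-! ### Monotonicity in each fugacity (Proposition 6: "non-decreasing in `y` and `z`") -/

/-- `0 ≤ C_{T,n}(y,z)` for `y, z ≥ 0`. [cite: BeatonBousquetMelouDeGierDuminilCopinGuttmann2014, §3.2 (arXiv v5 p. 10: C_{T,k}(y,z))] -/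
theorem stripZ₂_nonneg (T n : ℕ) (hy : 0 ≤ y) (hz : 0 ≤ z) : 0 ≤ stripZ₂ T n y z :=
  Finset.sum_nonneg fun _ _ => mul_nonneg (pow_nonneg hy _) (pow_nonneg hz _)

/-- `C_{T,n}(y,z) ≤ C_{T,n}(y',z)` for `0 ≤ y ≤ y'`, `0 ≤ z` (term by term).
[cite: BeatonBousquetMelouDeGierDuminilCopinGuttmann2014, Proposition 6 (arXiv v5 p. 10: "non-decreasing in y and z")] -/
theorem stripZ₂_mono_left (T n : ℕ) (hy : 0 ≤ y) (hyy' : y ≤ y') (hz : 0 ≤ z) :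
    stripZ₂ T n y z ≤ stripZ₂ T n y' z :=
  Finset.sum_le_sum fun _ _ => mul_le_mul_of_nonneg_right (pow_le_pow_left₀ hy hyy' _) (pow_nonneg hz _)

/-- `C_{T,n}(y,z) ≤ C_{T,n}(y,z')` for `0 ≤ z ≤ z'`, `0 ≤ y` (by the symmetry `C_{T,n}(y,z) = C_{T,n}(z,y)`).
[cite: BeatonBousquetMelouDeGierDuminilCopinGuttmann2014, Proposition 6 (arXiv v5 p. 10: "non-decreasing in y and z")] -/
theorem stripZ₂_mono_right (T n : ℕ) (hy : 0 ≤ y) (hz : 0 ≤ z) (hzz' : z ≤ z') :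
    stripZ₂ T n y z ≤ stripZ₂ T n y z' := by
  rw [stripZ₂_symm T n y z, stripZ₂_symm T n y z']
  exact stripZ₂_mono_left T n hz hzz' hy

/-- **Proposition 6: `μ_T(y,z)` is non-decreasing in `y`** (`0 < y ≤ y'`, `0 < z`).
[cite: BeatonBousquetMelouDeGierDuminilCopinGuttmann2014, Proposition 6 (arXiv v5 p. 10: "μ_T(y,z) is finite, and non-decreasing in y and z")] -/
theorem stripMuY₂_mono_left (T : ℕ) (hy : 0 < y) (hyy' : y ≤ y') (hz : 0 < z) :
    stripMuY₂ T y z ≤ stripMuY₂ T y' z :=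
  le_of_tendsto_of_tendsto' (tendsto_stripZ₂_rpow T hy hz) (tendsto_stripZ₂_rpow T (hy.trans_le hyy') hz) fun n =>
    Real.rpow_le_rpow (stripZ₂_nonneg T n hy.le hz.le) (stripZ₂_mono_left T n hy.le hyy' hz.le) (by positivity)

/-- **Proposition 6: `μ_T(y,z)` is non-decreasing in `z`** (`0 < y`, `0 < z ≤ z'`).
[cite: BeatonBousquetMelouDeGierDuminilCopinGuttmann2014, Proposition 6 (arXiv v5 p. 10: "non-decreasing in y and z")] -/
theorem stripMuY₂_mono_right (T : ℕ) (hy : 0 < y) (hz : 0 < z) (hzz' : z ≤ z') :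
    stripMuY₂ T y z ≤ stripMuY₂ T y z' := by
  rw [stripMuY₂_symm T y z, stripMuY₂_symm T y z']
  exact stripMuY₂_mono_left T hz hzz' hy

/-! ### Joint log-convexity in `(log y, log z)` (Hölder on `C_{T,n}(y,z)`) -/

/-- Joint Hölder: `C_{T,n}(y₁^θ y₂^{1-θ}, z₁^θ z₂^{1-θ}) ≤ C_{T,n}(y₁,z₁)^θ · C_{T,n}(y₂,z₂)^{1-θ}` for `0 < θ < 1`.
[cite: BeatonBousquetMelouDeGierDuminilCopinGuttmann2014, Proposition 6 (arXiv v5 p. 10: "log-convex"); HammersleyTorrieWhittington1982, §2 (2.12)] -/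
theorem stripZ₂_rpow_mul_rpow_le (T : ℕ) (hy₁ : 0 < y₁) (hy₂ : 0 < y₂) (hz₁ : 0 < z₁) (hz₂ : 0 < z₂)
    (hθ0 : 0 < θ) (hθ1 : θ < 1) (n : ℕ) :
    stripZ₂ T n (y₁ ^ θ * y₂ ^ (1 - θ)) (z₁ ^ θ * z₂ ^ (1 - θ)) ≤
      stripZ₂ T n y₁ z₁ ^ θ * stripZ₂ T n y₂ z₂ ^ (1 - θ) := by
  have hpq : θ⁻¹.HolderConjugate (1 - θ)⁻¹ := Real.HolderConjugate.inv_one_sub_inv hθ0 hθ1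
  have h1θ : 0 < 1 - θ := sub_pos.2 hθ1
  unfold stripZ₂
  have key := Real.inner_le_Lp_mul_Lq_of_nonneg (stripPairs T n) hpq
      (f := fun p => (y₁ ^ bottomVisits₀ p.1 p.2 n * z₁ ^ topVisits₀ T p.1 p.2 n) ^ θ)
      (g := fun p => (y₂ ^ bottomVisits₀ p.1 p.2 n * z₂ ^ topVisits₀ T p.1 p.2 n) ^ (1 - θ))
      (fun p _ => by positivity) (fun p _ => by positivity)
  have hf : ∀ p : Site 2 × (ℕ → Site 2),
      ((y₁ ^ bottomVisits₀ p.1 p.2 n * z₁ ^ topVisits₀ T p.1 p.2 n) ^ θ) ^ θ⁻¹ =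
        y₁ ^ bottomVisits₀ p.1 p.2 n * z₁ ^ topVisits₀ T p.1 p.2 n :=
    fun p => Real.rpow_rpow_inv (by positivity) hθ0.ne'
  have hg : ∀ p : Site 2 × (ℕ → Site 2),
      ((y₂ ^ bottomVisits₀ p.1 p.2 n * z₂ ^ topVisits₀ T p.1 p.2 n) ^ (1 - θ)) ^ (1 - θ)⁻¹ =
        y₂ ^ bottomVisits₀ p.1 p.2 n * z₂ ^ topVisits₀ T p.1 p.2 n :=
    fun p => Real.rpow_rpow_inv (by positivity) h1θ.ne'
  have hfg : ∀ p : Site 2 × (ℕ → Site 2),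
      (y₁ ^ bottomVisits₀ p.1 p.2 n * z₁ ^ topVisits₀ T p.1 p.2 n) ^ θ *
          (y₂ ^ bottomVisits₀ p.1 p.2 n * z₂ ^ topVisits₀ T p.1 p.2 n) ^ (1 - θ) =
        (y₁ ^ θ * y₂ ^ (1 - θ)) ^ bottomVisits₀ p.1 p.2 n * (z₁ ^ θ * z₂ ^ (1 - θ)) ^ topVisits₀ T p.1 p.2 n :=
    fun p => by
      rw [Real.mul_rpow (pow_nonneg hy₁.le _) (pow_nonneg hz₁.le _),
        Real.mul_rpow (pow_nonneg hy₂.le _) (pow_nonneg hz₂.le _), mul_pow, mul_pow,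
        ← Real.rpow_pow_comm hy₁.le, ← Real.rpow_pow_comm hy₂.le, ← Real.rpow_pow_comm hz₁.le,
        ← Real.rpow_pow_comm hz₂.le]
      ring
  simp only [one_div, inv_inv, hf, hg, hfg] at key
  exact key

/-- **`μ_T(y₁^θ y₂^{1-θ}, z₁^θ z₂^{1-θ}) ≤ μ_T(y₁,z₁)^θ · μ_T(y₂,z₂)^{1-θ}`** (`0 ≤ θ ≤ 1`): joint log-convexity of the
two-fugacity growth rate in `(log y, log z)`.
[cite: BeatonBousquetMelouDeGierDuminilCopinGuttmann2014, Proposition 6 (arXiv v5 p. 10: "μ_T(1,y) is a log-convex … function of log(y)"); HammersleyTorrieWhittington1982, §2 (2.12)] -/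
theorem stripMuY₂_rpow_mul_rpow_le (T : ℕ) (hy₁ : 0 < y₁) (hy₂ : 0 < y₂) (hz₁ : 0 < z₁) (hz₂ : 0 < z₂)
    (hθ0 : 0 ≤ θ) (hθ1 : θ ≤ 1) :
    stripMuY₂ T (y₁ ^ θ * y₂ ^ (1 - θ)) (z₁ ^ θ * z₂ ^ (1 - θ)) ≤
      stripMuY₂ T y₁ z₁ ^ θ * stripMuY₂ T y₂ z₂ ^ (1 - θ) := by
  rcases hθ0.eq_or_lt with rfl | hθ0'
  · simp
  rcases hθ1.eq_or_lt with rfl | hθ1'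
  · simp
  have hy : 0 < y₁ ^ θ * y₂ ^ (1 - θ) := mul_pos (Real.rpow_pos_of_pos hy₁ _) (Real.rpow_pos_of_pos hy₂ _)
  have hz : 0 < z₁ ^ θ * z₂ ^ (1 - θ) := mul_pos (Real.rpow_pos_of_pos hz₁ _) (Real.rpow_pos_of_pos hz₂ _)
  refine le_of_tendsto_of_tendsto' (tendsto_stripZ₂_rpow T hy hz)
    (((tendsto_stripZ₂_rpow T hy₁ hz₁).rpow_const (Or.inr hθ0)).mul
      ((tendsto_stripZ₂_rpow T hy₂ hz₂).rpow_const (Or.inr (sub_nonneg.2 hθ1)))) fun n => ?_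
  have h := stripZ₂_rpow_mul_rpow_le T hy₁ hy₂ hz₁ hz₂ hθ0' hθ1' n
  have h₁ := stripZ₂_nonneg T n hy₁.le hz₁.le
  have h₂ := stripZ₂_nonneg T n hy₂.le hz₂.le
  calc stripZ₂ T n (y₁ ^ θ * y₂ ^ (1 - θ)) (z₁ ^ θ * z₂ ^ (1 - θ)) ^ (1 / (n : ℝ))
      ≤ (stripZ₂ T n y₁ z₁ ^ θ * stripZ₂ T n y₂ z₂ ^ (1 - θ)) ^ (1 / (n : ℝ)) :=
        Real.rpow_le_rpow (stripZ₂_nonneg T n hy.le hz.le) h (by positivity)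
    _ = (stripZ₂ T n y₁ z₁ ^ (1 / (n : ℝ))) ^ θ * (stripZ₂ T n y₂ z₂ ^ (1 / (n : ℝ))) ^ (1 - θ) := by
        rw [Real.mul_rpow (Real.rpow_nonneg h₁ _) (Real.rpow_nonneg h₂ _), ← Real.rpow_mul h₁, ← Real.rpow_mul h₂,
          mul_comm θ, mul_comm (1 - θ), Real.rpow_mul h₁, Real.rpow_mul h₂]

/-- The same in logarithms: `log μ_T(y₁^θ y₂^{1-θ}, z₁^θ z₂^{1-θ}) ≤ θ log μ_T(y₁,z₁) + (1-θ) log μ_T(y₂,z₂)`.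
[cite: BeatonBousquetMelouDeGierDuminilCopinGuttmann2014, Proposition 6 (arXiv v5 p. 10)] -/
theorem log_stripMuY₂_rpow_mul_rpow_le (T : ℕ) (hy₁ : 0 < y₁) (hy₂ : 0 < y₂) (hz₁ : 0 < z₁) (hz₂ : 0 < z₂)
    (hθ0 : 0 ≤ θ) (hθ1 : θ ≤ 1) :
    Real.log (stripMuY₂ T (y₁ ^ θ * y₂ ^ (1 - θ)) (z₁ ^ θ * z₂ ^ (1 - θ))) ≤
      θ * Real.log (stripMuY₂ T y₁ z₁) + (1 - θ) * Real.log (stripMuY₂ T y₂ z₂) := by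
  have hy : 0 < y₁ ^ θ * y₂ ^ (1 - θ) := mul_pos (Real.rpow_pos_of_pos hy₁ _) (Real.rpow_pos_of_pos hy₂ _)
  have hz : 0 < z₁ ^ θ * z₂ ^ (1 - θ) := mul_pos (Real.rpow_pos_of_pos hz₁ _) (Real.rpow_pos_of_pos hz₂ _)
  have hp₁ := stripMuY₂_pos T hy₁ hz₁
  have hp₂ := stripMuY₂_pos T hy₂ hz₂
  calc Real.log (stripMuY₂ T (y₁ ^ θ * y₂ ^ (1 - θ)) (z₁ ^ θ * z₂ ^ (1 - θ)))
      ≤ Real.log (stripMuY₂ T y₁ z₁ ^ θ * stripMuY₂ T y₂ z₂ ^ (1 - θ)) :=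
        Real.log_le_log (stripMuY₂_pos T hy hz) (stripMuY₂_rpow_mul_rpow_le T hy₁ hy₂ hz₁ hz₂ hθ0 hθ1)
    _ = θ * Real.log (stripMuY₂ T y₁ z₁) + (1 - θ) * Real.log (stripMuY₂ T y₂ z₂) := by
        rw [Real.log_mul (Real.rpow_pos_of_pos hp₁ _).ne' (Real.rpow_pos_of_pos hp₂ _).ne', Real.log_rpow hp₁,
          Real.log_rpow hp₂]

/-- **Joint log-convexity: `(u,v) ↦ log μ_T(eᵘ, eᵛ)` is convex on `ℝ × ℝ`**, for every `T` (the printed clause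
"`μ_T(1,y)` is a log-convex function of `log y`" is its restriction to the line `u = 0`).
[cite: BeatonBousquetMelouDeGierDuminilCopinGuttmann2014, Proposition 6 (arXiv v5 p. 10: "Finally, μ_T(1,y) is a log-convex and thus continuous function of log(y)"); HammersleyTorrieWhittington1982, §2 (2.12)] -/
theorem convexOn_log_stripMuY₂_exp (T : ℕ) :
    ConvexOn ℝ Set.univ (fun p : ℝ × ℝ => Real.log (stripMuY₂ T (Real.exp p.1) (Real.exp p.2))) := by
  refine ⟨convex_univ, fun p _ q _ a b ha hb hab => ?_⟩
  obtain rfl : b = 1 - a := by linarith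
  simp only [Prod.fst_add, Prod.smul_fst, Prod.snd_add, Prod.smul_snd, smul_eq_mul]
  have hexp : ∀ s t : ℝ, Real.exp (a * s + (1 - a) * t) = Real.exp s ^ a * Real.exp t ^ (1 - a) := fun s t => by
    rw [Real.exp_add, mul_comm a, mul_comm (1 - a), Real.exp_mul, Real.exp_mul]
  rw [hexp, hexp]
  exact log_stripMuY₂_rpow_mul_rpow_le T (Real.exp_pos _) (Real.exp_pos _) (Real.exp_pos _) (Real.exp_pos _) ha
    (by linarith)

/-! ### The two-sided `√`-law (parity of the weighted rows) -/

/-- **`C_{T,n}(y',z) ≤ (y'/y)^{n/2+1} · C_{T,n}(y,z)` for `0 < y ≤ y'`, `0 ≤ z`** (term by term, `bc(ω) ≤ n/2 + 1`).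
[cite: BeatonBousquetMelouDeGierDuminilCopinGuttmann2014, §3.2, Proposition 6 (arXiv v5 p. 10: C_{T,k}(y,z) = Σ y^{bc(ω)} z^{tc(ω)})] -/
theorem stripZ₂_le_pow_half_mul_left (T n : ℕ) (hy : 0 < y) (hyy' : y ≤ y') (hz : 0 ≤ z) :
    stripZ₂ T n y' z ≤ (y' / y) ^ (n / 2 + 1) * stripZ₂ T n y z := by
  have hq : 1 ≤ y' / y := (one_le_div hy).2 hyy'
  unfold stripZ₂
  rw [Finset.mul_sum]
  refine Finset.sum_le_sum fun p hp => ?_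
  have hbw := (mem_stripPairs.1 hp).2.2.1
  have hb : bottomVisits₀ p.1 p.2 n ≤ n / 2 + 1 := bottomVisits₀_le_div_two_succ p.1 p.2 hbw
  have e : y' ^ bottomVisits₀ p.1 p.2 n = (y' / y) ^ bottomVisits₀ p.1 p.2 n * y ^ bottomVisits₀ p.1 p.2 n := by
    rw [← mul_pow, div_mul_cancel₀ _ hy.ne']
  rw [e, mul_assoc]
  exact mul_le_mul_of_nonneg_right (pow_le_pow_right₀ hq hb) (mul_nonneg (pow_nonneg hy.le _) (pow_nonneg hz _))

/-- **`μ_T(y',z) ≤ √(y'/y) · μ_T(y,z)` for every `T`, `0 < y ≤ y'`, `0 < z`**: in the bottom fugacity the two-sided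
rate grows at most like `√y`, uniformly in the top fugacity.
[cite: BeatonBousquetMelouDeGierDuminilCopinGuttmann2014, §3.2, Proposition 6 (arXiv v5 p. 10) and proof of Corollary 8 (p. 12: ρ_T(y) ≤ 1/√y)] -/
theorem stripMuY₂_le_sqrt_mul_left (T : ℕ) (hy : 0 < y) (hyy' : y ≤ y') (hz : 0 < z) :
    stripMuY₂ T y' z ≤ Real.sqrt (y' / y) * stripMuY₂ T y z := by
  have hy' : 0 < y' := lt_of_lt_of_le hy hyy'
  set q := y' / y with hqdef
  have hq1 : 1 ≤ q := (one_le_div hy).2 hyy'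
  have hq0 : 0 < q := lt_of_lt_of_le one_pos hq1
  have hL := tendsto_stripZ₂_rpow T hy' hz
  have hR : Tendsto (fun n : ℕ => q ^ (1 / 2 + 1 / (n : ℝ)) * (stripZ₂ T n y z) ^ (1 / (n : ℝ))) atTop
      (𝓝 (Real.sqrt q * stripMuY₂ T y z)) := (tendsto_rpow_half_add_inv hq0).mul (tendsto_stripZ₂_rpow T hy hz)
  refine le_of_tendsto_of_tendsto hL hR ?_
  filter_upwards [Filter.eventually_ge_atTop 1] with n hn
  have hZ := stripZ₂_le_pow_half_mul_left T n hy hyy' hz.le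
  have hZ0 : 0 ≤ stripZ₂ T n y' z := (stripZ₂_pos T n hy' hz).le
  have hZy : 0 ≤ stripZ₂ T n y z := (stripZ₂_pos T n hy hz).le
  have h1 : stripZ₂ T n y' z ^ (1 / (n : ℝ)) ≤ ((q ^ (n / 2 + 1) * stripZ₂ T n y z)) ^ (1 / (n : ℝ)) :=
    Real.rpow_le_rpow hZ0 hZ (by positivity)
  have h2 : (q ^ (n / 2 + 1) * stripZ₂ T n y z) ^ (1 / (n : ℝ)) =
      (q ^ (n / 2 + 1)) ^ (1 / (n : ℝ)) * (stripZ₂ T n y z) ^ (1 / (n : ℝ)) :=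
    Real.mul_rpow (pow_nonneg hq0.le _) hZy
  have h3 : (q ^ (n / 2 + 1)) ^ (1 / (n : ℝ)) ≤ q ^ (1 / 2 + 1 / (n : ℝ)) := by
    rw [← Real.rpow_natCast q (n / 2 + 1), ← Real.rpow_mul hq0.le]
    refine Real.rpow_le_rpow_of_exponent_le hq1 ?_
    have hd : (((n / 2 + 1 : ℕ)) : ℝ) ≤ (n : ℝ) / 2 + 1 := by
      have : ((n / 2 : ℕ) : ℝ) ≤ (n : ℝ) / 2 := by
        rw [le_div_iff₀ (by norm_num : (0:ℝ) < 2)]; exact_mod_cast Nat.div_mul_le_self n 2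
      push_cast; linarith
    have hn0 : (0 : ℝ) < n := by exact_mod_cast hn
    calc (((n / 2 + 1 : ℕ)) : ℝ) * (1 / (n : ℝ)) ≤ ((n : ℝ) / 2 + 1) * (1 / (n : ℝ)) :=
          mul_le_mul_of_nonneg_right hd (by positivity)
      _ = 1 / 2 + 1 / (n : ℝ) := by field_simp
  calc stripZ₂ T n y' z ^ (1 / (n : ℝ)) ≤ (q ^ (n / 2 + 1)) ^ (1 / (n : ℝ)) * (stripZ₂ T n y z) ^ (1 / (n : ℝ)) :=
        h2 ▸ h1
    _ ≤ q ^ (1 / 2 + 1 / (n : ℝ)) * (stripZ₂ T n y z) ^ (1 / (n : ℝ)) :=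
        mul_le_mul_of_nonneg_right h3 (Real.rpow_nonneg hZy _)

/-- **`μ_T(y,z') ≤ √(z'/z) · μ_T(y,z)` for every `T`, `0 < y`, `0 < z ≤ z'`** (the top row, by `μ_T(y,z) = μ_T(z,y)`).
[cite: BeatonBousquetMelouDeGierDuminilCopinGuttmann2014, §3.2, Proposition 6 (arXiv v5 p. 10: "By the symmetry of bridges, μ_T(y,z) = μ_T(z,y)")] -/
theorem stripMuY₂_le_sqrt_mul_right (T : ℕ) (hy : 0 < y) (hz : 0 < z) (hzz' : z ≤ z') :
    stripMuY₂ T y z' ≤ Real.sqrt (z' / z) * stripMuY₂ T y z := by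
  rw [stripMuY₂_symm T y z', stripMuY₂_symm T y z]
  exact stripMuY₂_le_sqrt_mul_left T hz hzz' hy

/-- **The two-sided `√`-law: `μ_T(y',z') ≤ √(y'/y) · √(z'/z) · μ_T(y,z)`** for every `T`, `0 < y ≤ y'`, `0 < z ≤ z'`.
[cite: BeatonBousquetMelouDeGierDuminilCopinGuttmann2014, §3.2, Proposition 6 (arXiv v5 p. 10) and proof of Corollary 8 (p. 12)] -/
theorem stripMuY₂_le_sqrt_mul_sqrt_mul (T : ℕ) (hy : 0 < y) (hyy' : y ≤ y') (hz : 0 < z) (hzz' : z ≤ z') :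
    stripMuY₂ T y' z' ≤ Real.sqrt (y' / y) * Real.sqrt (z' / z) * stripMuY₂ T y z := by
  have hz' : 0 < z' := lt_of_lt_of_le hz hzz'
  calc stripMuY₂ T y' z' ≤ Real.sqrt (y' / y) * stripMuY₂ T y z' := stripMuY₂_le_sqrt_mul_left T hy hyy' hz'
    _ ≤ Real.sqrt (y' / y) * (Real.sqrt (z' / z) * stripMuY₂ T y z) :=
        mul_le_mul_of_nonneg_left (stripMuY₂_le_sqrt_mul_right T hy hz hzz') (Real.sqrt_nonneg _)
    _ = Real.sqrt (y' / y) * Real.sqrt (z' / z) * stripMuY₂ T y z := by ring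

/-- **`y ↦ μ_T(y,z)/√y` is non-increasing on `(0,∞)`** for every `T` and `z > 0`.
[cite: BeatonBousquetMelouDeGierDuminilCopinGuttmann2014, §3.2, Proposition 6 (arXiv v5 p. 10)] -/
theorem antitoneOn_stripMuY₂_div_sqrt_left (T : ℕ) (hz : 0 < z) :
    AntitoneOn (fun y : ℝ => stripMuY₂ T y z / Real.sqrt y) (Set.Ioi 0) := by
  intro y hy y' _ hyy'
  have hy0 : (0:ℝ) < y := hy
  have hy' : 0 < y' := lt_of_lt_of_le hy0 hyy'
  have h := stripMuY₂_le_sqrt_mul_left T hy0 hyy' hz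
  have hsy' : 0 < Real.sqrt y' := Real.sqrt_pos.2 hy'
  rw [Real.sqrt_div hy'.le] at h
  show stripMuY₂ T y' z / Real.sqrt y' ≤ stripMuY₂ T y z / Real.sqrt y
  rw [div_le_iff₀ hsy']
  calc stripMuY₂ T y' z ≤ Real.sqrt y' / Real.sqrt y * stripMuY₂ T y z := h
    _ = stripMuY₂ T y z / Real.sqrt y * Real.sqrt y' := by ring

/-- **`z ↦ μ_T(y,z)/√z` is non-increasing on `(0,∞)`** for every `T` and `y > 0`.
[cite: BeatonBousquetMelouDeGierDuminilCopinGuttmann2014, §3.2, Proposition 6 (arXiv v5 p. 10)] -/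
theorem antitoneOn_stripMuY₂_div_sqrt_right (T : ℕ) (hy : 0 < y) :
    AntitoneOn (fun z : ℝ => stripMuY₂ T y z / Real.sqrt z) (Set.Ioi 0) := by
  intro z hz z' hz' hzz'
  have h := antitoneOn_stripMuY₂_div_sqrt_left T hy hz hz' hzz'
  simpa only [stripMuY₂_symm T y] using h

/-! ### Joint continuity ("and thus continuous"), from the joint log-convexity -/

/-- `(u,v) ↦ log μ_T(eᵘ,eᵛ)` is continuous on `ℝ × ℝ` (a finite convex function on an open set of a finite-dimensional
space is continuous). [cite: BeatonBousquetMelouDeGierDuminilCopinGuttmann2014, Proposition 6 (arXiv v5 p. 10: "log-convex and thus continuous")] -/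
theorem continuous_log_stripMuY₂_exp (T : ℕ) :
    Continuous (fun p : ℝ × ℝ => Real.log (stripMuY₂ T (Real.exp p.1) (Real.exp p.2))) :=
  continuousOn_univ.1 ((convexOn_log_stripMuY₂_exp T).continuousOn isOpen_univ)

/-- **`(y,z) ↦ μ_T(y,z)` is jointly continuous on `(0,∞)²`**, for every `T`.
[cite: BeatonBousquetMelouDeGierDuminilCopinGuttmann2014, Proposition 6 (arXiv v5 p. 10: "μ_T(1,y) is a log-convex and thus continuous function of log(y)")] -/
theorem continuousOn_stripMuY₂ (T : ℕ) :
    ContinuousOn (fun p : ℝ × ℝ => stripMuY₂ T p.1 p.2) (Set.Ioi 0 ×ˢ Set.Ioi 0) := by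
  have hF := continuous_log_stripMuY₂_exp T
  have hG : ContinuousOn (fun q : ℝ × ℝ => (Real.log q.1, Real.log q.2)) (Set.Ioi (0 : ℝ) ×ˢ Set.Ioi (0 : ℝ)) := by
    refine ContinuousOn.prodMk ?_ ?_
    · refine continuousOn_fst.log fun q hq => ?_
      exact (ne_of_gt (show (0 : ℝ) < q.1 from hq.1))
    · refine continuousOn_snd.log fun q hq => ?_
      exact (ne_of_gt (show (0 : ℝ) < q.2 from hq.2))
  have hEFG := (hF.comp_continuousOn hG).rexp
  refine hEFG.congr fun q hq => ?_
  have h1 : (0 : ℝ) < q.1 := hq.1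
  have h2 : (0 : ℝ) < q.2 := hq.2
  show stripMuY₂ T q.1 q.2 = Real.exp (Real.log (stripMuY₂ T (Real.exp (Real.log q.1)) (Real.exp (Real.log q.2))))
  rw [Real.exp_log h1, Real.exp_log h2, Real.exp_log (stripMuY₂_pos T h1 h2)]

end Literature.Probability.RandomPlanarGeometry.SAW.HexBW
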